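import Summits.AtomisticToContinuum.BoseEinsteinCondensation.Theses.BECPhaseQuadratureSumRule
import Summits.AtomisticToContinuum.BoseEinsteinCondensation.Theorems.BECPhaseQuadratureSumRuleSmoothPartnerSoftBall
import Summits.AtomisticToContinuum.BoseEinsteinCondensation.Theorems.BECPhaseQuadratureSumRuleSmoothPartnerCoupling
import Literature.MathematicalPhysics.QuantumManyBody.HardCoreScatteringLength
import HarnessLib

/-!
# Route BECPhaseQuadratureSumRule — `SmoothPartner` PROVED (item stmt-AtomisticToContinuum-12628)

Every repulsive finite-range `w` has a bounded smooth-class partner `v` — finite, `C²` as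
`x ↦ v(|x|)` on `ℝ³`, with the edge condition `‖D²ṽ‖ ≤ Cₑ √ṽ`, finite range — with the same
scattering length. Construction: `a := a(w) ≤ max(R₀, 0) < ∞` (`scatteringLength_le_range`); if
`a = 0` take `v = 0` (`scatteringLength_zero`); else `v = v_s`, the soft ball
`v_s(r) = s ((4a)² − r²)₊⁴` of `BECPhaseQuadratureSumRuleSmoothPartnerSoftBall`, with `s` from the
intermediate value theorem of `BECPhaseQuadratureSumRuleSmoothPartnerCoupling`: `a(v_s) = O(s)`
(Spruch–Rosenberg) and `a(v_s) ≥ 2a − √(2/K) = a` for `K = s (12a²)⁴ = 2/a²` (the square well of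
radius `2a` and height `K` sits inside `v_s`; `scatteringLength_squareWell_bounds`).
-/

noncomputable section

open MeasureTheory Set Filter Topology Metric
open scoped ENNReal NNReal

namespace Summit.AtomisticToContinuum.BoseEinsteinCondensation.Theorems

open Literature.MathematicalPhysics.QuantumManyBody.BoseGas

/-! ### The route statement -/

/-- **`SmoothPartner` (route `BECPhaseQuadratureSumRule`, item stmt-AtomisticToContinuum-12628),
proved.** Every repulsive finite-range `w` has a bounded smooth-class partner with the same
scattering length: `v = 0` if `a(w) = 0`, else `v = s (16a² − r²)₊⁴` with `s` from the
intermediate value theorem applied to the continuous monotone `s ↦ a(v_s)`, which is `O(s)` for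
small `s` (Spruch–Rosenberg) and `≥ a` for `s (12a²)⁴ = 2/a²` (square well of radius `2a` inside
`v_s`, `a(well) ≥ R − √(2/K)`). [cite: LSSY2005, App. C Thm. C.1, Lemma C.2, (C.10)] -/
theorem smoothPartner_proof : Theses.BECPhaseQuadratureSumRule.SmoothPartner := by
  intro w hw
  obtain ⟨-, R₀, hR₀⟩ := hw
  have haw_le : scatteringLength w ≤ ENNReal.ofReal (max R₀ 0) :=
    scatteringLength_le_range (le_max_right _ _) fun r hr =>
      hR₀ r ((le_max_left _ _).trans_lt hr)
  have haw_ne : scatteringLength w ≠ ⊤ := ne_top_of_le_ne_top ENNReal.ofReal_ne_top haw_le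
  set A : ℝ := (scatteringLength w).toReal with hA_def
  have hA0 : 0 ≤ A := ENNReal.toReal_nonneg
  rcases hA0.eq_or_lt with hA | hA
  · -- `a(w) = 0`: the free gas is a partner
    have haw0 : scatteringLength w = 0 :=
      ((ENNReal.toReal_eq_zero_iff _).mp hA.symm).resolve_right haw_ne
    have hfun : (fun x : Space => ((fun _ : ℝ => (0 : ℝ≥0∞)) ‖x‖).toReal) = fun _ => (0 : ℝ) := by
      funext x; simp
    refine ⟨fun _ => 0, ⟨measurable_const, 0, fun _ _ => rfl⟩, fun _ => ENNReal.zero_ne_top,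
      ?_, ⟨0, fun x => ?_⟩, ⟨0, fun _ => le_rfl⟩, ?_⟩
    · rw [hfun]; exact contDiff_const
    · rw [hfun, iteratedFDeriv_fun_zero]; simp
    · show scatteringLength (0 : ℝ → ℝ≥0∞) = scatteringLength w
      rw [scatteringLength_zero, haw0]
  · -- `a(w) = A > 0`: the soft ball of radius `4A`
    set R : ℝ := 4 * A with hR_def
    have hR : 0 < R := by positivity
    set f : ℝ → ℝ := fun r => (max (R ^ 2 - r ^ 2) 0) ^ 4 with hf_def
    have hf : ∀ r, 0 ≤ f r := fun r => by positivity
    -- uniform bound `a(s f) ≤ R` (finite range)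
    have hB : ∀ s, scatteringLength (fun r => ENNReal.ofReal (s * f r)) ≤ ENNReal.ofReal R :=
      fun s => scatteringLength_le_range hR.le fun r hr => softBall_eq_zero hR.le hr
    have hne : ∀ s, scatteringLength (fun r => ENNReal.ofReal (s * f r)) ≠ ⊤ :=
      fun s => ne_top_of_le_ne_top ENNReal.ofReal_ne_top (hB s)
    -- small coupling: `a(s f) ≤ s c₀`
    have hfc : Continuous fun x : Space => f ‖x‖ :=
      ((continuous_const.sub (continuous_norm.pow 2)).max continuous_const).pow 4
    have hsupp : HasCompactSupport fun x : Space => f ‖x‖ := by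
      refine HasCompactSupport.intro (isCompact_closedBall (0 : Space) R) fun x hx => ?_
      have hxR : R < ‖x‖ := by simpa using hx
      show (max (R ^ 2 - ‖x‖ ^ 2) 0) ^ 4 = 0
      rw [max_eq_right (by nlinarith), zero_pow four_ne_zero]
    have hJ : ∫⁻ x : Space, ENNReal.ofReal (f ‖x‖) < ⊤ :=
      (hfc.integrable_of_hasCompactSupport hsupp).lintegral_lt_top
    set X : ℝ≥0∞ := (ENNReal.ofReal (4 * Real.pi))⁻¹ *
      (2⁻¹ * ∫⁻ x : Space, ENNReal.ofReal (f ‖x‖)) with hX_def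
    have h4 : ENNReal.ofReal (4 * Real.pi) ≠ 0 := by
      rw [ENNReal.ofReal_ne_zero_iff]; positivity
    have hX : X ≠ ⊤ := ENNReal.mul_ne_top (ENNReal.inv_ne_top.2 h4)
      (ENNReal.mul_ne_top (ENNReal.inv_ne_top.2 two_ne_zero) hJ.ne)
    set c₀ : ℝ := X.toReal with hc₀_def
    have hc₀ : 0 ≤ c₀ := ENNReal.toReal_nonneg
    have hsmall : ∀ s, 0 ≤ s →
        (scatteringLength (fun r => ENNReal.ofReal (s * f r))).toReal ≤ s * c₀ := by
      intro s hs
      have h1 := ENNReal.toReal_mono (ENNReal.mul_ne_top ENNReal.ofReal_ne_top hX)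
        (scatteringLength_smul_le (f := f) hs)
      rwa [ENNReal.toReal_mul, ENNReal.toReal_ofReal hs] at h1
    set s₁ : ℝ := A / (c₀ + 1) with hs₁_def
    have hs₁ : 0 < s₁ := by positivity
    have h₁ : (scatteringLength (fun r => ENNReal.ofReal (s₁ * f r))).toReal ≤ A := by
      refine (hsmall s₁ hs₁.le).trans ?_
      rw [hs₁_def, div_mul_eq_mul_div, div_le_iff₀ (by positivity)]
      nlinarith
    -- large coupling: the square well of radius `2A` and height `K = 2/A²` sits inside `s₂ f`
    set K : ℝ := 2 / A ^ 2 with hK_def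
    have hK : 0 < K := by positivity
    set s₂ : ℝ := K / (12 * A ^ 2) ^ 4 with hs₂_def
    have hs₂ : 0 < s₂ := by positivity
    have hwell : ∀ r, 0 < r →
        (Set.Iic (2 * A)).indicator (fun _ : ℝ => ENNReal.ofReal K) r ≤
          ENNReal.ofReal (s₂ * f r) := by
      intro r hr
      by_cases hr2 : r ≤ 2 * A
      · rw [Set.indicator_of_mem (show r ∈ Set.Iic (2 * A) from hr2)]
        refine ENNReal.ofReal_le_ofReal ?_
        have hf12 : (12 * A ^ 2) ^ 4 ≤ f r := by
          simp only [hf_def, hR_def]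
          refine pow_le_pow_left₀ (by positivity) (le_max_of_le_left ?_) 4
          nlinarith
        calc K = s₂ * (12 * A ^ 2) ^ 4 := by rw [hs₂_def]; field_simp
          _ ≤ s₂ * f r := mul_le_mul_of_nonneg_left hf12 hs₂.le
      · rw [squareWell_eq_zero (lt_of_not_ge hr2)]
        exact zero_le
    have h₂ : A ≤ (scatteringLength (fun r => ENNReal.ofReal (s₂ * f r))).toReal := by
      have hlow := (scatteringLength_squareWell_bounds hK (by positivity : 0 < 2 * A)).1
      have hsqrt : Real.sqrt (2 / K) = A := by
        rw [show 2 / K = A ^ 2 by rw [hK_def]; field_simp]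
        exact Real.sqrt_sq hA.le
      rw [hsqrt, show 2 * A - A = A by ring] at hlow
      exact (ENNReal.ofReal_le_iff_le_toReal (hne s₂)).1
        (hlow.trans (scatteringLength_mono_Ioi hwell))
    -- intermediate value theorem
    obtain ⟨s, hs, hgs⟩ := exists_toReal_scatteringLength_smul_eq hf hR.le hB hs₁ h₁ h₂
    refine ⟨fun r => ENNReal.ofReal (s * f r), isRepulsiveFiniteRange_softBall hR.le s,
      fun _ => ENNReal.ofReal_ne_top, contDiff_softBall hs.le, edge_softBall hR.le hs.le,
      ⟨(s * (R ^ 2) ^ 4).toNNReal, softBall_le hs.le⟩, ?_⟩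
    exact (ENNReal.toReal_eq_toReal_iff' (hne s) haw_ne).1 hgs

end Summit.AtomisticToContinuum.BoseEinsteinCondensation.Theorems

end
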